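import Summits.ResolutionOfSingularities.ResolutionOfSingularities.Theorems.WeightedInvariantLocalWeightedDropNCDirectrixCutWeierstrass
import Summits.ResolutionOfSingularities.ResolutionOfSingularities.Theorems.WeightedInvariantLocalWeightedDropNCDirectrixCutHist
import Summits.ResolutionOfSingularities.ResolutionOfSingularities.Theorems.WeightedInvariantLocalWeightedDropNCResRegimeDefs
import Summits.ResolutionOfSingularities.ResolutionOfSingularities.Theorems.WeightedInvariantLocalWeightedDropNCDirectrixCutWeierstrassFactors

/-!
# `WeightedInvariant.LocalWeightedDrop` (stmt-ResolutionOfSingularities-8899), registered stub W′|₄ `stub_wildWideApexFourStartsWon`: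
# THE ODD-`p` GOOD CORNER FROM ITS LEAVES R ∧ C ∧ Core — F discharged by name

[OURS · route `ResolutionOfSingularities/WeightedInvariant` · ENGINE crux `LocalWeightedDrop` (stmt-ResolutionOfSingularities-8899), skeleton v36
`ae852bbacee88029`, registered stub W′|₄ · res-L1-w43-strat-1's ORDER-`p` split (`g10/orderp_split_v2.lean`, concluder 1 kernel-checked there modulo
F · R · C · Core).  Candidates of the programme's own count game; nothing here is a statement of, or about, any manuscript; AI-written, weaker than expert
review; counted 0; proves no summit and closes no registered stub.]

## What this file does (the strategist's concluder 1 VERBATIM with F := the tree's `weierstrassFactorsOfReducible`; no definition, no new axiom)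

* `coreUnaryWildGoodThreeOrderPOdd_of_leaves` — **the unary-position-split stub `stub_coreUnaryWildGoodThreeOrderPOdd` (`o = p` odd, GOOD position)
  VERBATIM ⟸ R `stub_reducibleOrderP` (order-`p` germs splitting into two tame factors; Kawanoue–Matsuki-class, XL) ∧ C `stub_cpScopeIrredOrderP`
  (Cossart–Piltant 2019 engine port) ∧ Core `stub_irredOutsideCPScopeOddP` (irreducible, outside CP scope, `p` odd — NOT IN PRINT)**, all three VERBATIM;
  this is hypothesis `hodd` of `UnaryPositionCensus.coreUnaryWildThree_of_leaves` (`…NCDirectrixCutUnaryPositionGlue`).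
-/

set_option linter.dupNamespace false -- mandated namespace of this single-conjunct summit

noncomputable section

namespace Summit.ResolutionOfSingularities.ResolutionOfSingularities.Theorems

namespace TameFourTupleDrop

namespace OddCoreCensus

open MvPowerSeries Literature.AlgebraicGeometry.Resolution

/-- **The odd-`p` GOOD corner from R ∧ C ∧ Core** (module docstring): reducible presentations by R, irreducible ones in CP scope by C, the rest is the
core; the dichotomy reducible/irreducible by the tree's F `weierstrassFactorsOfReducible`. [OURS · W′|₄ kernel census] -/
theorem coreUnaryWildGoodThreeOrderPOdd_of_leaves
    (hR :
    ∀ (p : ℕ), p.Prime → ∀ (k : Type) [Field k] [CharP k p] [IsAlgClosed k],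
      ∀ (b : MvPowerSeries (Fin 4) k) (δ : Decoration k 3) (Φ : Fin 4 → MvPowerSeries (Fin 4) k) (u hW : MvPowerSeries (Fin 4) k)
        (bc cc : ℕ → MvPowerSeries (Fin 4) k) (d₁ d₂ : ℕ),
        Admissible b δ → δ.O = ∅ → δ.o = p →
        (∀ i, constantCoeff (Φ i) = 0) → IsUnit (Matrix.det (Matrix.of fun i j => coeff (Finsupp.single j 1) (Φ i))) →
        (∀ l ∈ δ.E, ∃ (l' : Fin 4) (v : MvPowerSeries (Fin 4) k), l' ≠ 0 ∧ constantCoeff v ≠ 0 ∧ Φ l = v * X l') →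
        constantCoeff u ≠ 0 →
        (∀ i (n : Fin 4 →₀ ℕ), n 0 ≠ 0 → coeff n (bc i) = 0) → (∀ j (n : Fin 4 →₀ ℕ), n 0 ≠ 0 → coeff n (cc j) = 0) →
        0 < d₁ → 0 < d₂ → d₁ + d₂ = p →
        hW = (X 0 ^ d₁ + ∑ i ∈ Finset.range d₁, bc i * X 0 ^ i) * (X 0 ^ d₂ + ∑ j ∈ Finset.range d₂, cc j * X 0 ^ j) →
        subst Φ δ.f = u * hW →
        DWinsTo (St := MvPowerSeries (Fin 4) k × Decoration k 3) Prod.fst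
          (fun τ => GermIsNC τ.1 ∨ (Admissible τ.1 τ.2 ∧ (τ.2.head < δ.head ∨ (τ.2.head = δ.head ∧ ¬ UnaryVertex τ.2)))) (b, δ))
    (hC :
    ∀ (p : ℕ), p.Prime → ∀ (k : Type) [Field k] [CharP k p] [IsAlgClosed k],
      ∀ (b : MvPowerSeries (Fin 4) k) (δ : Decoration k 3) (Φ : Fin 4 → MvPowerSeries (Fin 4) k) (u hW : MvPowerSeries (Fin 4) k)
        (a : ℕ → MvPowerSeries (Fin 4) k),
        Admissible b δ → δ.O = ∅ → δ.o = p →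
        (∀ i, constantCoeff (Φ i) = 0) → IsUnit (Matrix.det (Matrix.of fun i j => coeff (Finsupp.single j 1) (Φ i))) →
        (∀ l ∈ δ.E, ∃ (l' : Fin 4) (v : MvPowerSeries (Fin 4) k), l' ≠ 0 ∧ constantCoeff v ≠ 0 ∧ Φ l = v * X l') →
        constantCoeff u ≠ 0 → (∀ i (n : Fin 4 →₀ ℕ), n 0 ≠ 0 → coeff n (a i) = 0) →
        hW = X 0 ^ p + ∑ i ∈ Finset.range p, a i * X 0 ^ i → subst Φ δ.f = u * hW →
        Irreducible hW →
        ((∀ i, 0 < i → i < p → a i = 0) ∨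
          (∃ G : MvPowerSeries (Fin 4) k, (hW ∣ G ^ p + ∑ i ∈ Finset.range p, a i * G ^ i) ∧ ¬ (hW ∣ G - X 0))) →
        DWinsTo (St := MvPowerSeries (Fin 4) k × Decoration k 3) Prod.fst
          (fun τ => GermIsNC τ.1 ∨ (Admissible τ.1 τ.2 ∧ (τ.2.head < δ.head ∨ (τ.2.head = δ.head ∧ ¬ UnaryVertex τ.2)))) (b, δ))
    (hCore :
    ∀ (p : ℕ), p.Prime → p ≠ 2 → ∀ (k : Type) [Field k] [CharP k p] [IsAlgClosed k],
      ∀ (b : MvPowerSeries (Fin 4) k) (δ : Decoration k 3), Admissible b δ → 2 ≤ δ.o → UnaryVertex δ → δ.O = ∅ → δ.o = p → δ.GoodDir →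
        (∀ (Φ : Fin 4 → MvPowerSeries (Fin 4) k) (u hW : MvPowerSeries (Fin 4) k) (a : ℕ → MvPowerSeries (Fin 4) k),
        (∀ i, constantCoeff (Φ i) = 0) → IsUnit (Matrix.det (Matrix.of fun i j => coeff (Finsupp.single j 1) (Φ i))) →
          (∀ l ∈ δ.E, ∃ (l' : Fin 4) (v : MvPowerSeries (Fin 4) k), l' ≠ 0 ∧ constantCoeff v ≠ 0 ∧ Φ l = v * X l') →
          constantCoeff u ≠ 0 → (∀ i (n : Fin 4 →₀ ℕ), n 0 ≠ 0 → coeff n (a i) = 0) →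
          hW = X 0 ^ p + ∑ i ∈ Finset.range p, a i * X 0 ^ i → subst Φ δ.f = u * hW →
          Irreducible hW ∧ ¬ ((∀ i, 0 < i → i < p → a i = 0) ∨
            (∃ G : MvPowerSeries (Fin 4) k, (hW ∣ G ^ p + ∑ i ∈ Finset.range p, a i * G ^ i) ∧ ¬ (hW ∣ G - X 0)))) →
        DWinsTo (St := MvPowerSeries (Fin 4) k × Decoration k 3) Prod.fst
          (fun τ => GermIsNC τ.1 ∨ (Admissible τ.1 τ.2 ∧ (τ.2.head < δ.head ∨ (τ.2.head = δ.head ∧ ¬ UnaryVertex τ.2)))) (b, δ)) :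
    ∀ (p : ℕ), p.Prime → p ≠ 2 → ∀ (k : Type) [Field k] [CharP k p] [IsAlgClosed k],
      ∀ (b : MvPowerSeries (Fin 4) k) (δ : Decoration k 3), Admissible b δ → 2 ≤ δ.o → UnaryVertex δ → δ.O = ∅ → δ.o = p → δ.GoodDir →
        DWinsTo (St := MvPowerSeries (Fin 4) k × Decoration k 3) Prod.fst
          (fun τ => GermIsNC τ.1 ∨ (Admissible τ.1 τ.2 ∧ (τ.2.head < δ.head ∨ (τ.2.head = δ.head ∧ ¬ UnaryVertex τ.2)))) (b, δ) := by
  intro p hp hp2 k _ _ _ b δ hadm ho2 hU hO hop hg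
  by_cases hred : ∃ (Φ : Fin 4 → MvPowerSeries (Fin 4) k) (u hW : MvPowerSeries (Fin 4) k) (a : ℕ → MvPowerSeries (Fin 4) k),
      (∀ i, constantCoeff (Φ i) = 0) ∧ IsUnit (Matrix.det (Matrix.of fun i j => coeff (Finsupp.single j 1) (Φ i))) ∧
      (∀ l ∈ δ.E, ∃ (l' : Fin 4) (v : MvPowerSeries (Fin 4) k), l' ≠ 0 ∧ constantCoeff v ≠ 0 ∧ Φ l = v * X l') ∧
      constantCoeff u ≠ 0 ∧ (∀ i (n : Fin 4 →₀ ℕ), n 0 ≠ 0 → coeff n (a i) = 0) ∧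
      hW = X 0 ^ p + ∑ i ∈ Finset.range p, a i * X 0 ^ i ∧ subst Φ δ.f = u * hW ∧ ¬ Irreducible hW
  · obtain ⟨Φ, u, hW, a, hΦ0, hΦdet, hE, hu, ha, hhW, hWf, hirr⟩ := hred
    obtain ⟨d₁, d₂, bc, cc, hd₁, hd₂, hsum, hbc, hcc, hfac⟩ := weierstrassFactorsOfReducible p hp k b δ Φ u hW a hadm hop hΦ0 hΦdet hu ha hhW hWf hirr
    exact hR p hp k b δ Φ u hW bc cc d₁ d₂ hadm hO hop hΦ0 hΦdet hE hu hbc hcc hd₁ hd₂ hsum hfac hWf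
  · by_cases hsc : ∃ (Φ : Fin 4 → MvPowerSeries (Fin 4) k) (u hW : MvPowerSeries (Fin 4) k) (a : ℕ → MvPowerSeries (Fin 4) k),
      (∀ i, constantCoeff (Φ i) = 0) ∧ IsUnit (Matrix.det (Matrix.of fun i j => coeff (Finsupp.single j 1) (Φ i))) ∧
      (∀ l ∈ δ.E, ∃ (l' : Fin 4) (v : MvPowerSeries (Fin 4) k), l' ≠ 0 ∧ constantCoeff v ≠ 0 ∧ Φ l = v * X l') ∧
      constantCoeff u ≠ 0 ∧ (∀ i (n : Fin 4 →₀ ℕ), n 0 ≠ 0 → coeff n (a i) = 0) ∧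
      hW = X 0 ^ p + ∑ i ∈ Finset.range p, a i * X 0 ^ i ∧ subst Φ δ.f = u * hW ∧
      ((∀ i, 0 < i → i < p → a i = 0) ∨
      (∃ G : MvPowerSeries (Fin 4) k, (hW ∣ G ^ p + ∑ i ∈ Finset.range p, a i * G ^ i) ∧ ¬ (hW ∣ G - X 0)))
    · obtain ⟨Φ, u, hW, a, hΦ0, hΦdet, hE, hu, ha, hhW, hWf, hsc'⟩ := hsc
      have hirr : Irreducible hW := by
        by_contra hirr
        exact hred ⟨Φ, u, hW, a, hΦ0, hΦdet, hE, hu, ha, hhW, hWf, hirr⟩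
      exact hC p hp k b δ Φ u hW a hadm hO hop hΦ0 hΦdet hE hu ha hhW hWf hirr hsc'
    · refine hCore p hp hp2 k b δ hadm ho2 hU hO hop hg fun Φ u hW a hΦ0 hΦdet hE hu ha hhW hWf => ⟨?_, ?_⟩
      · by_contra hirr
        exact hred ⟨Φ, u, hW, a, hΦ0, hΦdet, hE, hu, ha, hhW, hWf, hirr⟩
      · exact fun hsc' => hsc ⟨Φ, u, hW, a, hΦ0, hΦdet, hE, hu, ha, hhW, hWf, hsc'⟩

end OddCoreCensus

end TameFourTupleDrop

end Summit.ResolutionOfSingularities.ResolutionOfSingularities.Theorems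

end
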